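import Mathlib
import Summits.RiemannHypothesis.RiemannHypothesis.Theorems.WeilFarCoercivityFloor
import Summits.RiemannHypothesis.RiemannHypothesis.Theorems.WeilFarFloorOrder
import Summits.RiemannHypothesis.RiemannHypothesis.Theorems.WeilFarFloorKappaRoot
import HarnessLib

/-!
# The floor law's main term EXACTLY: `pntFloor a = e^a + 2a − 2 + O(a²e^{−a})`

Helper file (`--supports stmt-RiemannHypothesis-0098`, lead-track anchor: Weil-positivity window ladder, format-C far bound),
RH-free, pure proofs.  Seat rh-explicit-weil-1 gen9 (memo `run/shared/lean/pub/rh-explicit/rh-explicit-weil-1/FORMAT-K3.md` §10.11).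
`WeilFarCoercivityFloor` defines the PNT-kernel eigenvalue `L(a) = pntFloor a = 1/(κ² − ¼)`, `κ = pntKappa a` the root of
`κ·tanh(κa) = ½` (`FloorGrowth.sInf_pntKappaSet_spec`).  With `δ = κ − ½` one has EXACTLY `L = 1/(δ(1 + δ))` and the fixed-point
equation `δ = (1 + δ)e^{−a}e^{−2δa}` (`FloorGrowth.kappa_sub_half_eq`), whence `(1 + δ)L + 1 = e^a·e^{2δa}` and, expanding `e^{2δa}`
to second order (`δ ≤ 1.157e^{−a}`, `2δa ≤ 0.63`):

* `abs_pntFloor_sub_le` — **`|pntFloor a − (e^a + 2a − 2)| ≤ 14·a²·e^{−a}` for every `a ≥ 2`**;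
* `tendsto_pntFloor_sub` — `pntFloor a − (e^a + 2a) → −2` (`a → ∞`).

This pins the constant of the main term (`WeilFarFloorMainTerm` had the two-sided `e^a + 2a − 4 ≤ L ≤ e^a + 2a` for `a ≥ 4`): the
centring of the floor law C-XIII is `L(a) − 2γ_E = e^a + 2a − 2 − 2γ_E + O(a²e^{−a})`.  Standard axioms only.
-/

set_option linter.dupNamespace false
set_option autoImplicit false

noncomputable section

open Set Filter Topology

namespace Summit.RiemannHypothesis.RiemannHypothesis.Theorems.WeilFormatC

namespace FloorMainTerm

variable {a : ℝ}

/-- `e^{−2} ≤ 0.1354` and `a·e^{−a} ≤ 0.271` for `a ≥ 2`. -/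
theorem exp_neg_bounds (ha : 2 ≤ a) : Real.exp (-a) ≤ 1354 / 10000 ∧ a * Real.exp (-a) ≤ 271 / 1000 := by
  have he2 : Real.exp (-2) ≤ 1354 / 10000 := by
    have : Real.exp (-2) = Real.exp (-1) ^ 2 := by rw [← Real.exp_nat_mul]; norm_num
    rw [this]; nlinarith [Real.exp_neg_one_lt_d9, Real.exp_pos (-1 : ℝ)]
  have hea : Real.exp (-a) ≤ Real.exp (-2) := Real.exp_le_exp.2 (by linarith)
  refine ⟨hea.trans he2, ?_⟩
  -- a ≤ 2 e^{a−2}, i.e. a e^{−a} ≤ 2 e^{−2}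
  have h1 : a - 2 + 1 ≤ Real.exp (a - 2) := Real.add_one_le_exp (a - 2)
  have h2 : 1 ≤ Real.exp (a - 2) := Real.one_le_exp (by linarith)
  have h3 : a ≤ 2 * Real.exp (a - 2) := by linarith
  have h4 : Real.exp (a - 2) * Real.exp (-a) = Real.exp (-2) := by rw [← Real.exp_add]; ring_nf
  have h5 : a * Real.exp (-a) ≤ 2 * Real.exp (-2) := by
    have := mul_le_mul_of_nonneg_right h3 (Real.exp_pos (-a)).le
    linarith [this, h4]
  linarith

/-- The final arithmetic, isolated: with `T = E + 2a − 2`, `(1+δ)L + 1 = E(1 + x + r)`, `u = δE = (1+δ)·ex`, `x = 2δa`,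
`1 − x ≤ ex ≤ 1`, `0 ≤ r ≤ x²`, `δ ≤ 1.157·Em`, `a·Em ≤ 0.271` (`Em = e^{−a}`), the deviation `|L − T|` is at most `14a²·Em`. -/
theorem core_arith {a δ E Em L x r ex : ℝ} (ha : 2 ≤ a) (hδ0 : 0 < δ) (hE : 0 < E)
    (hδ : δ ≤ 1157 / 1000 * Em) (haEm : a * Em ≤ 271 / 1000) (hEm1 : Em ≤ 1354 / 10000)
    (hx : x = 2 * δ * a) (hex1 : 1 - x ≤ ex) (hex2 : ex ≤ 1)
    (hr0 : 0 ≤ r) (hr : r ≤ x ^ 2) (hu : δ * E = (1 + δ) * ex) (hL : (1 + δ) * L + 1 = E * (1 + x + r)) :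
    |L - (E + 2 * a - 2)| ≤ 14 * a ^ 2 * Em := by
  have hEm0 : 0 < Em := by nlinarith
  have ha0 : 0 < a := by linarith
  have hx0 : 0 ≤ x := by rw [hx]; positivity
  -- x ≤ 0.63
  have hxle : x ≤ 63 / 100 := by
    rw [hx]
    have : δ * a ≤ 1157 / 1000 * (a * Em) := by nlinarith
    nlinarith
  have hδle : δ ≤ 157 / 1000 := by nlinarith
  -- the identity (1+δ)(L − T) = (2a − 1)(u − 1) + E r − δ(2a − 2), u = δE
  have hid : (1 + δ) * (L - (E + 2 * a - 2))
      = (2 * a - 1) * (δ * E - 1) + E * r - δ * (2 * a - 2) := by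
    have hxE : E * x = 2 * a * (δ * E) := by rw [hx]; ring
    linear_combination hL + hxE
  -- bounds on u − 1 and E r
  have hu1 : |δ * E - 1| ≤ δ + (1 + δ) * x := by
    rw [hu, abs_le]; constructor <;> nlinarith
  have hEr : E * r ≤ 2 * a * (1 + δ) * x := by
    have h1 : E * r ≤ E * x ^ 2 := by nlinarith
    have h2 : E * x ^ 2 = 2 * a * (δ * E) * x := by rw [hx]; ring
    rw [h2, hu] at h1
    have h3 : 2 * a * ((1 + δ) * ex) * x ≤ 2 * a * (1 + δ) * x := by
      have h4 : 0 ≤ 2 * a * (1 + δ) * x := by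
        have : 0 ≤ 1 + δ := by linarith
        positivity
      have h5 := mul_le_mul_of_nonneg_left hex2 h4
      calc 2 * a * ((1 + δ) * ex) * x = 2 * a * (1 + δ) * x * ex := by ring
        _ ≤ 2 * a * (1 + δ) * x * 1 := h5
        _ = 2 * a * (1 + δ) * x := by ring
    linarith
  have hEr0 : 0 ≤ E * r := by positivity
  -- |(1+δ)(L − T)| ≤ δ (9.256 a² + 4a)
  have habs : |(1 + δ) * (L - (E + 2 * a - 2))| ≤ δ * (9256 / 1000 * a ^ 2 + 4 * a) := by
    rw [hid]
    have h2a : 0 ≤ 2 * a - 1 := by linarith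
    calc |(2 * a - 1) * (δ * E - 1) + E * r - δ * (2 * a - 2)|
        ≤ |(2 * a - 1) * (δ * E - 1)| + |E * r| + |δ * (2 * a - 2)| := by
          have := abs_add_le ((2 * a - 1) * (δ * E - 1) + E * r) (-(δ * (2 * a - 2)))
          have := abs_add_le ((2 * a - 1) * (δ * E - 1)) (E * r)
          rw [abs_neg] at *
          have h' : (2 * a - 1) * (δ * E - 1) + E * r - δ * (2 * a - 2)
              = (2 * a - 1) * (δ * E - 1) + E * r + -(δ * (2 * a - 2)) := by ring
          rw [h']
          linarith
      _ ≤ (2 * a - 1) * (δ + (1 + δ) * x) + 2 * a * (1 + δ) * x + δ * (2 * a - 2) := by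
          rw [abs_mul, abs_of_nonneg h2a, abs_of_nonneg hEr0, abs_of_nonneg (by nlinarith : 0 ≤ δ * (2 * a - 2))]
          have := mul_le_mul_of_nonneg_left hu1 h2a
          linarith
      _ ≤ δ * (9256 / 1000 * a ^ 2 + 4 * a) := by
          rw [hx]; nlinarith [mul_pos hδ0 ha0, mul_pos (mul_pos hδ0 ha0) ha0]
  -- divide by 1 + δ ≥ 1 and use δ ≤ 1.157 Em, 4.63 a ≤ 2.32 a²
  have h1 : |L - (E + 2 * a - 2)| ≤ |(1 + δ) * (L - (E + 2 * a - 2))| := by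
    rw [abs_mul, abs_of_pos (by linarith : (0 : ℝ) < 1 + δ)]
    have := abs_nonneg (L - (E + 2 * a - 2))
    nlinarith
  refine h1.trans (habs.trans ?_)
  have hq : 0 ≤ 9256 / 1000 * a ^ 2 + 4 * a := by positivity
  calc δ * (9256 / 1000 * a ^ 2 + 4 * a) ≤ 1157 / 1000 * Em * (9256 / 1000 * a ^ 2 + 4 * a) :=
        mul_le_mul_of_nonneg_right hδ hq
    _ ≤ 14 * a ^ 2 * Em := by nlinarith [mul_pos hEm0 ha0, mul_pos (mul_pos hEm0 ha0) ha0]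

/-- **The main term exactly**: `|pntFloor a − (e^a + 2a − 2)| ≤ 14·a²·e^{−a}` for every `a ≥ 2`. -/
theorem abs_pntFloor_sub_le (ha : 2 ≤ a) :
    |pntFloor a - (Real.exp a + 2 * a - 2)| ≤ 14 * a ^ 2 * Real.exp (-a) := by
  obtain ⟨hκ, heig⟩ := FloorGrowth.sInf_pntKappaSet_spec (by linarith : 0 < a)
  unfold pntFloor pntKappa
  set κ := sInf {κ : ℝ | 1 / 2 < κ ∧ 1 / 2 ≤ κ * Real.tanh (κ * a)} with hκdef
  have hfix := FloorGrowth.kappa_sub_half_eq heig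
  set δ := κ - 1 / 2 with hδdef
  have hδ0 : 0 < δ := by rw [hδdef]; linarith
  have hk : κ + 1 / 2 = 1 + δ := by rw [hδdef]; ring
  rw [hk] at hfix
  obtain ⟨hEm1, haEm⟩ := exp_neg_bounds ha
  set x := 2 * δ * a with hxdef
  -- e^{−2κa} = e^{−a} e^{−x}
  have hsplit : Real.exp (-(2 * (κ * a))) = Real.exp (-a) * Real.exp (-x) := by
    rw [← Real.exp_add]; congr 1; rw [hxdef, hδdef]; ring
  rw [hsplit] at hfix
  have hEEm : Real.exp a * Real.exp (-a) = 1 := by rw [← Real.exp_add, add_neg_cancel, Real.exp_zero]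
  -- δ ≤ 1.157 e^{−a}
  have hex2 : Real.exp (-x) ≤ 1 := Real.exp_le_one_iff.2 (by rw [hxdef]; nlinarith)
  have hδ : δ ≤ 1157 / 1000 * Real.exp (-a) := by
    have h1 : δ ≤ (1 + δ) * Real.exp (-a) := by
      have h2 := mul_le_mul_of_nonneg_left (mul_le_mul_of_nonneg_left hex2 (Real.exp_pos (-a)).le)
        (by linarith : (0 : ℝ) ≤ 1 + δ)
      rw [mul_one, ← hfix] at h2
      exact h2
    nlinarith [Real.exp_pos (-a)]
  have hx0 : 0 ≤ x := by rw [hxdef]; positivity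
  have hxle : x ≤ 1 := by
    rw [hxdef]
    have : δ * a ≤ 1157 / 1000 * (a * Real.exp (-a)) := by nlinarith [Real.exp_pos (-a)]
    nlinarith
  have hex1 : 1 - x ≤ Real.exp (-x) := Real.one_sub_le_exp_neg x
  -- e^{x} = 1 + x + r with 0 ≤ r ≤ x²
  have hr := Real.abs_exp_sub_one_sub_id_le (show |x| ≤ 1 by rwa [abs_of_nonneg hx0])
  have hr0 : 0 ≤ Real.exp x - 1 - x := by linarith [Real.add_one_le_exp x]
  rw [abs_of_nonneg hr0] at hr
  -- u = δ e^a = (1+δ) e^{−x}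
  have hu : δ * Real.exp a = (1 + δ) * Real.exp (-x) := by
    have h1 : δ * Real.exp a = (1 + δ) * (Real.exp (-a) * Real.exp (-x)) * Real.exp a := by rw [← hfix]
    rw [h1]
    calc (1 + δ) * (Real.exp (-a) * Real.exp (-x)) * Real.exp a
        = (1 + δ) * Real.exp (-x) * (Real.exp a * Real.exp (-a)) := by ring
      _ = (1 + δ) * Real.exp (-x) := by rw [hEEm, mul_one]
  -- (1+δ) L + 1 = e^a e^x, with L = 1/(κ² − 1/4) = 1/(δ(1+δ))
  have hL : (1 + δ) * (1 / (κ ^ 2 - 1 / 4)) + 1 = Real.exp a * (1 + x + (Real.exp x - 1 - x)) := by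
    have hk2 : κ ^ 2 - 1 / 4 = δ * (1 + δ) := by rw [hδdef]; ring
    rw [hk2]
    have hxx : Real.exp x * Real.exp (-x) = 1 := by rw [← Real.exp_add, add_neg_cancel, Real.exp_zero]
    have hδ1 : (1 + δ) * (1 / (δ * (1 + δ))) + 1 = (1 + δ) / δ := by
      have : (1 + δ) ≠ 0 := by positivity
      field_simp
    rw [hδ1, div_eq_iff hδ0.ne']
    -- (1+δ) = e^a (e^x) δ  ⇔ δ e^a e^x = 1 + δ
    have : δ * Real.exp a * Real.exp x = 1 + δ := by
      rw [hu]
      calc (1 + δ) * Real.exp (-x) * Real.exp x = (1 + δ) * (Real.exp x * Real.exp (-x)) := by ring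
        _ = 1 + δ := by rw [hxx, mul_one]
    linear_combination -this
  exact core_arith ha hδ0 (Real.exp_pos a) hδ haEm hEm1 hxdef hex1 hex2 hr0 hr hu hL

/-- **Corollary**: `pntFloor a − (e^a + 2a) → −2` as `a → ∞`. -/
theorem tendsto_pntFloor_sub : Tendsto (fun a : ℝ ↦ pntFloor a - (Real.exp a + 2 * a)) atTop (𝓝 (-2)) := by
  -- a² e^{−a} → 0
  have h0 : Tendsto (fun a : ℝ ↦ 14 * a ^ 2 * Real.exp (-a)) atTop (𝓝 0) := by
    have h := (Real.tendsto_pow_mul_exp_neg_atTop_nhds_zero 2).const_mul 14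
    rw [mul_zero] at h
    refine h.congr fun a ↦ ?_
    ring
  have hlo : Tendsto (fun a : ℝ ↦ -2 - 14 * a ^ 2 * Real.exp (-a)) atTop (𝓝 (-2)) := by
    simpa using (tendsto_const_nhds (x := (-2 : ℝ))).sub h0
  have hhi : Tendsto (fun a : ℝ ↦ -2 + 14 * a ^ 2 * Real.exp (-a)) atTop (𝓝 (-2)) := by
    simpa using (tendsto_const_nhds (x := (-2 : ℝ))).add h0
  refine tendsto_of_tendsto_of_tendsto_of_le_of_le' hlo hhi ?_ ?_
  · filter_upwards [eventually_ge_atTop 2] with a ha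
    have := (abs_le.1 (abs_pntFloor_sub_le ha)).1
    linarith
  · filter_upwards [eventually_ge_atTop 2] with a ha
    have := (abs_le.1 (abs_pntFloor_sub_le ha)).2
    linarith

/-- `pntFloor a / e^a → 1`: the main term is `e^a` to leading order. -/
theorem tendsto_pntFloor_div_exp : Tendsto (fun a : ℝ ↦ pntFloor a / Real.exp a) atTop (𝓝 1) := by
  -- (pntFloor a − (e^a + 2a)) e^{−a} → 0 and 2a e^{−a} → 0
  have h1 : Tendsto (fun a : ℝ ↦ (pntFloor a - (Real.exp a + 2 * a)) * Real.exp (-a)) atTop (𝓝 0) := by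
    have := tendsto_pntFloor_sub.mul Real.tendsto_exp_neg_atTop_nhds_zero
    simpa using this
  have h2 : Tendsto (fun a : ℝ ↦ 2 * a * Real.exp (-a)) atTop (𝓝 0) := by
    have h := (Real.tendsto_pow_mul_exp_neg_atTop_nhds_zero 1).const_mul 2
    rw [mul_zero] at h
    refine h.congr fun a ↦ ?_
    ring
  have h3 := (h1.add h2).add_const 1
  rw [zero_add, zero_add] at h3
  refine h3.congr fun a ↦ ?_
  have hEEm : Real.exp a * Real.exp (-a) = 1 := by rw [← Real.exp_add, add_neg_cancel, Real.exp_zero]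
  rw [div_eq_mul_inv, ← Real.exp_neg]
  linear_combination -hEEm

end FloorMainTerm

end Summit.RiemannHypothesis.RiemannHypothesis.Theorems.WeilFormatC
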